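import Summits.NavierStokesRegularity.NavierStokesRegularity.Theorems.ScenarioCensusInertialMeter
import Literature.Analysis.FluidPDE.LeiZhang2011Proofs
import Summits.NavierStokesRegularity.NavierStokesRegularity.Theorems.SoloSalvageWu2026ConstructCompactV
import Summits.NavierStokesRegularity.NavierStokesRegularity.Theorems.UnthreadedRigidityDoorUnthreadedRigidityThreadingJets
import Summits.NavierStokesRegularity.NavierStokesRegularity.Theorems.StrainDoorsTypeIAncientCompactness
import Summits.NavierStokesRegularity.NavierStokesRegularity.Theorems.ScenarioCensusGeneratorMeter
import HarnessLib

/-!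
# INERTIAL METER port, part 2/3: §E the acceleration read modulo boosts (no uniform acceleration, frozen-vorticity pockets); §F controls (the parasitic Galilean mode shows the rows' content is the GAUGE)

Re-homed for the scenario census (typer seat ns-census-typer-1 g10; the cells A2inV / A2inP / A2inT / A2inB / A2inA / A2inW are MEMBERS OF RECORD «DECIDED IN KERNEL IN FILES» of row A2
(item 88: critic idea-crit-3 g10 PASS no price 13:11:05Z; ref ns-census-ref g15 PRE-CHECK ✓ §20.4; lead label v1.120; OF RECORD 4/4 at v1.122), A2inS / A2inG OPEN (typed); this port makes
the decided cells TREE-decided): VERBATIM PORT of ns-idea-2 LINE g18-1 «inertial-meter», `pub/ideators/ns-idea-2/lines/inertial-meter/line-inertial-meter.lean` sha16 78017c94d7e034e6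
(708 l., lean check rc 0, 0 sorry), split for the 400-line rule into `ScenarioCensusInertialMeter` (§A–§D) → `…InertialMeterAccel` (§E–§F) → `…InertialMeterRows` (§G + census KEYS).  Lean text VERBATIM in
namespace `…Theorems.ScenarioCensus.InertialMeter` (the line's `…Lines.InertialMeter` re-homed); port edits: the line's `local notation "E3"` is spelled as the reducible `abbrev E3` of
every census file; elementary lemmas the line restates are the tree's BY NAME (gate lint dedup.landed): `integrableOn_ball_of_continuous` = `Wu2026Salvage.integrableOn_ball_of_continuous`,
`volume_real_ball` = `volume_real_ball_eq` (Literature, Lei–Zhang 2011 proofs), `curl_sub_apply` = `UnthreadedRigidity.ThreadingJets.curl_fun_sub`, `curl_comp_add_right` = `StrainDoors.curl_comp_add_right_apply` (their modules are imported; none imports a route file), and `timeDeriv_eq_fderiv_uncurry` / `analyticAt_clm_apply` / `analyticOnNhd_timeDeriv` = the landed GENERATOR METER's (`GeneratorMeter.…`, BY NAME);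
`volume_real_unitBall_pos` (twin of a lemma in a route-cone module) and `divergence_sub_apply` (twin of a Literature lemma whose module is outside this closure) are not re-declared, their short proofs are inlined at the use sites; `set_option linter.unusedVariables false` dropped;
`@[conjecture]` on the OPEN rows `Row_A2inS`, `Row_A2inG`; one-line docstrings added where missing (gate lint).  Statements untouched.

No census VALUE is moved here (row A2 stays OPEN-WITH-LINE; the members become TREE-decided by name); (L′) is NOT proved; no summit statement is proved by this file. Lemmas that restate already-landed tree declarations are taken BY NAME (gate lint `dedup.landed`): `integrableOn_ball_of_continuous` = `Wu2026Salvage.integrableOn_ball_of_continuous`, `volume_real_ball` = `volume_real_ball_eq`, `curl_sub_apply` = `UnthreadedRigidity.ThreadingJets.curl_fun_sub`, `curl_comp_add_right` = `StrainDoors.curl_comp_add_right_apply`, `timeDeriv_eq_fderiv_uncurry` = `GeneratorMeter.timeDeriv_eq_fderiv_uncurry`, `analyticAt_clm_apply` = `GeneratorMeter.analyticAt_clm_apply`, `analyticOnNhd_timeDeriv` = `GeneratorMeter.analyticOnNhd_timeDeriv`.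
-/

-- the summit and its single problem share the name `NavierStokesRegularity` (D-0017 nested layout)
set_option linter.dupNamespace false

noncomputable section

open Set Function Filter Metric MeasureTheory
open scoped Topology
open Literature.Analysis Literature.Analysis.FluidPDE
open Summit.NavierStokesRegularity.NavierStokesRegularity.Theorems
open Summit.NavierStokesRegularity.NavierStokesRegularity.Theorems.ScenarioCensus

namespace Summit.NavierStokesRegularity.NavierStokesRegularity.Theorems.ScenarioCensus.InertialMeter

variable {C C' : ℝ} {u v : ℝ → E3 → E3}

/-! ## E. The acceleration read modulo boosts: NO UNIFORM ACCELERATION, frozen-vorticity pockets -/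

/-- Ball averages of a uniformly small continuous field are small. -/
theorem norm_setAverage_ball_le {f : E3 → E3} (x₀ : E3) (R : ℝ) {M : ℝ} (hM : 0 ≤ M)
    (h : ∀ x, ‖f x‖ ≤ M) : ‖⨍ x in ball x₀ R, f x‖ ≤ M := by
  rw [setAverage_eq, norm_smul, norm_inv, Real.norm_of_nonneg measureReal_nonneg]
  have hint : ‖∫ x in ball x₀ R, f x‖ ≤ M * volume.real (ball x₀ R) :=
    norm_setIntegral_le_of_norm_le_const measure_ball_lt_top fun x _ => h x
  by_cases h0 : volume.real (ball x₀ R) = 0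
  · rw [h0, inv_zero, zero_mul]; exact hM
  · calc (volume.real (ball x₀ R))⁻¹ * ‖∫ x in ball x₀ R, f x‖
        ≤ (volume.real (ball x₀ R))⁻¹ * (M * volume.real (ball x₀ R)) :=
          mul_le_mul_of_nonneg_left hint (inv_nonneg.2 measureReal_nonneg)
      _ = M := by field_simp

/-- **NO UNIFORM ACCELERATION.**  If the acceleration of one slice is a CONSTANT vector, `∂ₜu(t₀,·) ≡ b`
on `ℝ³` (`t₀ < 0`), then `b = 0`.  Proof: the tree's Dong–Zhang bound `‖∂ₜ²u‖ ≤ A₂` on `[t₀, t₀+h₀] × ℝ³`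
(`exists_bound_iteratedDeriv_two`) and two mean-value inequalities give
`‖u(t₀+h, y) − u(t₀, y) − h b‖ ≤ A₂h²` uniformly in `y`; averaging over `B_R(0)` and letting `R → ∞`
(inertial law for both slices) leaves `h‖b‖ ≤ A₂h²` for all small `h > 0`. -/
theorem accel_eq_zero (hu : IsTypeIAncientMild C u) {t₀ : ℝ} (ht₀ : t₀ < 0) {b : E3}
    (h : ∀ x, timeDeriv u t₀ x = b) : b = 0 := by
  obtain ⟨A₂, h₀, hh₀, hth₀, hA₂⟩ := exists_bound_iteratedDeriv_two hu.1 hu.2.1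
    (fun s t hst ht x => hu.mild_eq_heatExtension hst ht x) hu.2.2.2 ht₀
  have hA₂0 : 0 ≤ A₂ := (norm_nonneg _).trans (hA₂ t₀ ⟨le_rfl, by linarith⟩ 0)
  have hd0 : ∀ y, deriv (fun s => u s y) t₀ = b := fun y => by rw [← timeDeriv_apply]; exact h y
  -- (a) pointwise Taylor estimate
  have hquad : ∀ η : ℝ, 0 < η → η ≤ h₀ → ∀ y, ‖u (t₀ + η) y - u t₀ y - η • b‖ ≤ A₂ * η ^ 2 := by
    intro η hη hηh₀ y
    have hder : ∀ τ ∈ Icc t₀ (t₀ + h₀), ‖deriv (fun s => u s y) τ - b‖ ≤ A₂ * (τ - t₀) := by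
      intro τ hτ
      have h1 := norm_image_sub_le_of_norm_deriv_le_segment' (f := deriv fun s => u s y)
        (f' := iteratedDeriv 2 fun s => u s y) (a := t₀) (b := t₀ + h₀) (C := A₂)
        (fun σ hσ => ((steadySlice_hasDerivAt_curve hu.1 y (by linarith [hσ.2])).2).hasDerivWithinAt)
        (fun σ hσ => hA₂ σ (Ico_subset_Icc_self hσ) y) τ hτ
      rwa [hd0 y] at h1
    set g : ℝ → E3 := fun s => u s y - (s - t₀) • b with hg
    have hgd : ∀ σ ∈ Icc t₀ (t₀ + η),
        HasDerivWithinAt g (deriv (fun s => u s y) σ - b) (Icc t₀ (t₀ + η)) σ := by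
      intro σ hσ
      have h1 : HasDerivAt (fun s => u s y) (deriv (fun s => u s y) σ) σ :=
        (steadySlice_hasDerivAt_curve hu.1 y (by linarith [hσ.2])).1
      have h2 : HasDerivAt (fun s : ℝ => (s - t₀) • b) ((1 : ℝ) • b) σ :=
        ((hasDerivAt_id σ).sub_const t₀).smul_const b
      rw [one_smul] at h2
      exact (h1.sub h2).hasDerivWithinAt
    have h2 := norm_image_sub_le_of_norm_deriv_le_segment' (f := g)
      (f' := fun σ => deriv (fun s => u s y) σ - b) (a := t₀) (b := t₀ + η) (C := A₂ * η) hgd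
      (fun σ hσ => (hder σ ⟨hσ.1, by linarith [hσ.2]⟩).trans (by nlinarith [hσ.2, hσ.1]))
      (t₀ + η) ⟨by linarith, le_rfl⟩
    have e : g (t₀ + η) - g t₀ = u (t₀ + η) y - u t₀ y - η • b := by
      simp only [hg, sub_self, zero_smul, sub_zero, add_sub_cancel_left]
      abel
    calc ‖u (t₀ + η) y - u t₀ y - η • b‖ = ‖g (t₀ + η) - g t₀‖ := by rw [e]
      _ ≤ A₂ * η * (t₀ + η - t₀) := h2
      _ = A₂ * η ^ 2 := by ring
  -- (b) average over `B_R(0)` and let `R → ∞`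
  have hsmall : ∀ η : ℝ, 0 < η → η ≤ h₀ → η * ‖b‖ ≤ A₂ * η ^ 2 := by
    intro η hη hηh₀
    have htη : t₀ + η < 0 := by linarith
    have hc1 := hu.continuous_slice htη
    have hc0 := hu.continuous_slice ht₀
    have hlim : Tendsto (fun R : ℝ => (⨍ x in ball (0 : E3) R, u (t₀ + η) x) -
        (⨍ x in ball (0 : E3) R, u t₀ x) - η • b) atTop (𝓝 (0 - 0 - η • b)) :=
      ((inertialLaw hu htη 0).sub (inertialLaw hu ht₀ 0)).sub tendsto_const_nhds
    have hbd : ∀ᶠ R in atTop, ‖(⨍ x in ball (0 : E3) R, u (t₀ + η) x) -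
        (⨍ x in ball (0 : E3) R, u t₀ x) - η • b‖ ≤ A₂ * η ^ 2 := by
      filter_upwards [eventually_gt_atTop (0 : ℝ)] with R hR
      rw [← setAverage_ball_sub_sub_const hc1 hc0 (η • b) 0 hR]
      exact norm_setAverage_ball_le 0 R (by positivity) (hquad η hη hηh₀)
    have hle := le_of_tendsto hlim.norm hbd
    simpa [norm_smul, Real.norm_of_nonneg hη.le] using hle
  -- (c) conclude `‖b‖ ≤ A₂ η` for all small `η > 0`
  have hb : ‖b‖ ≤ 0 := by
    by_contra hpos
    push Not at hpos
    set η : ℝ := min h₀ (‖b‖ / (2 * (A₂ + 1))) with hη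
    have hηpos : 0 < η := lt_min hh₀ (by positivity)
    have hηh₀ : η ≤ h₀ := min_le_left _ _
    have hηb : η ≤ ‖b‖ / (2 * (A₂ + 1)) := min_le_right _ _
    have h1 : ‖b‖ ≤ A₂ * η := by
      have := hsmall η hηpos hηh₀
      nlinarith
    have h2 : A₂ * η ≤ A₂ * (‖b‖ / (2 * (A₂ + 1))) := mul_le_mul_of_nonneg_left hηb hA₂0
    have h3 : A₂ * (‖b‖ / (2 * (A₂ + 1))) < ‖b‖ := by
      rw [mul_div_assoc', div_lt_iff₀ (by positivity)]
      nlinarith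
    linarith
  exact norm_le_zero_iff.1 hb

-- `timeDeriv_eq_fderiv_uncurry`: the line restates the tree's `GeneratorMeter.timeDeriv_eq_fderiv_uncurry`; taken BY NAME (gate lint dedup.landed).

-- `analyticAt_clm_apply`: the line restates the tree's `GeneratorMeter.analyticAt_clm_apply`; taken BY NAME (gate lint dedup.landed).

-- `analyticOnNhd_timeDeriv`: the line restates the tree's `GeneratorMeter.analyticOnNhd_timeDeriv`; taken BY NAME (gate lint dedup.landed).

/-- **UNIFORMLY ACCELERATING INSTANT on a germ kills.**  If `∂ₜu(t₀, ·) = b` (a constant vector) on a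
nonempty open set of one slice, then `u ≡ 0`: germ → slice by analyticity of `∂ₜu(t₀,·) − b`, `b = 0` by
`accel_eq_zero`, and ONE steady slice kills (tree `clockLaw_eq_zero_of_steady_slice` ⟨stmt-10572⟩). -/
theorem eq_zero_of_accelInstant_germ (hu : IsTypeIAncientMild C u) {t₀ : ℝ} (ht₀ : t₀ < 0)
    {U : Set E3} (hU : IsOpen U) (hne : U.Nonempty) {b : E3} (h : ∀ x ∈ U, timeDeriv u t₀ x = b) :
    ∀ t < 0, ∀ x, u t x = 0 := by
  have ha : AnalyticOnNhd ℝ (fun x => timeDeriv u t₀ x - b) univ := fun x hx =>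
    (GeneratorMeter.analyticOnNhd_timeDeriv hu ht₀ x hx).sub analyticAt_const
  have hall : ∀ x, timeDeriv u t₀ x = b := fun x =>
    sub_eq_zero.1 (ForceMeter.eq_zero_of_window ha hU hne (fun y hy => sub_eq_zero.2 (h y hy)) x)
  have hb : b = 0 := accel_eq_zero hu ht₀ hall
  exact clockLaw_eq_zero_of_steady_slice hu ht₀ fun x => by rw [hall x, hb]

/-- `∂ₜω = curl ∂ₜu` for a class element (tree `IsSmoothSpaceTimeOn.curl_timeDerivWithin_of_uniqueDiffOn`,
`(−∞,0)` open). -/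
theorem deriv_curl_eq_curl_timeDeriv (hu : IsTypeIAncientMild C u) {t : ℝ} (ht : t < 0) (x : E3) :
    deriv (fun s => curl (u s) x) t = curl (fun y => timeDeriv u t y) x := by
  have hS : IsSmoothSpaceTimeOn (Iio 0) u := hu.1
  have h1 := hS.curl_timeDerivWithin_of_uniqueDiffOn isOpen_Iio.uniqueDiffOn (mem_Iio.2 ht) x
  have e1 : timeDerivWithin (Iio 0) u t = fun y => timeDeriv u t y := by
    rw [timeDerivWithin_eq_deriv_of_isOpen_subset isOpen_Iio Subset.rfl (mem_Iio.2 ht) u]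
    funext y; rw [timeDeriv_apply]
  have e2 : timeDerivWithin (Iio 0) (vorticity u) t = fun y => deriv (fun s => curl (u s) y) t := by
    rw [timeDerivWithin_eq_deriv_of_isOpen_subset isOpen_Iio Subset.rfl (mem_Iio.2 ht) (vorticity u)]
    rfl
  rw [e1, e2] at h1
  exact h1.symm

/-- **FROZEN-VORTICITY POCKET kills.**  If `∂ₜω(t₀, x) = 0` for `x` in a nonempty open set of one slice
(the vorticity is momentarily stationary on a pocket), then `u ≡ 0`: the acceleration `a = ∂ₜu(t₀,·)` is
analytic with `curl a = ∂ₜω(t₀,·) = 0` on the pocket, hence on `ℝ³`; it is divergence-free (tree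
`anchor_divergence_timeDeriv_eq_zero`) and gauge-bounded (tree `exists_gauge_norm_timeDeriv_le_of_typeI`),
hence CONSTANT (§B) — a uniformly accelerating instant, killed by `eq_zero_of_accelInstant_germ`. -/
theorem eq_zero_of_frozenVorticity_pocket (hu : IsTypeIAncientMild C u) {t₀ : ℝ} (ht₀ : t₀ < 0)
    {U : Set E3} (hU : IsOpen U) (hne : U.Nonempty)
    (h : ∀ x ∈ U, deriv (fun s => curl (u s) x) t₀ = 0) : ∀ t < 0, ∀ x, u t x = 0 := by
  set a : E3 → E3 := fun y => timeDeriv u t₀ y with ha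
  have haA : AnalyticOnNhd ℝ a univ := GeneratorMeter.analyticOnNhd_timeDeriv hu ht₀
  have ha2 : ContDiff ℝ 2 a := contDiffOn_univ.1 (haA.contDiffOn (n := 2) uniqueDiffOn_univ)
  have hcurlU : ∀ x ∈ U, curl a x = 0 := fun x hx => by
    rw [ha, ← deriv_curl_eq_curl_timeDeriv hu ht₀ x]; exact h x hx
  have hcurl : ∀ x, curl a x = 0 := ForceMeter.eq_zero_of_window (analyticOnNhd_curl haA) hU hne hcurlU
  have hdiv : VectorCalculus.IsDivFree a := fun x => anchor_divergence_timeDeriv_eq_zero hu.1 hu.2.1 ht₀ x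
  obtain ⟨L, hL⟩ := exists_gauge_norm_timeDeriv_le_of_typeI C
  have hsq : 0 < Real.sqrt (-t₀) ^ 3 := pow_pos (Real.sqrt_pos.2 (neg_pos.2 ht₀)) 3
  have hB : ∃ B, ∀ x, ‖a x‖ ≤ B := ⟨L / Real.sqrt (-t₀) ^ 3, fun x => by
    rw [le_div_iff₀ hsq, mul_comm]; exact hL hu t₀ ht₀ x⟩
  have hconst : ∀ x, a x = a 0 := fun x => const_of_curlFree_divFree_bounded ha2 hcurl hdiv hB x 0
  exact eq_zero_of_accelInstant_germ hu ht₀ isOpen_univ univ_nonempty (b := a 0) fun x _ => hconst x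

/-! ## F. Controls: the parasitic Galilean mode shows the rows' content is the GAUGE -/

/-- The uniformly accelerating parasitic mode `u(t, x) = t • b` (classical NS with pressure `−⟪b, x⟫`). -/
def parasitic (b : E3) : ℝ → E3 → E3 := fun t _ => t • b

/-- Time derivative of the parasitic Galilean mode. -/
theorem parasitic_timeDeriv (b : E3) (t : ℝ) (x : E3) : timeDeriv (parasitic b) t x = b := by
  rw [timeDeriv_apply]
  show deriv (fun s : ℝ => s • b) t = b
  have := ((hasDerivAt_id t).smul_const b).deriv
  simpa using this

/-- The parasitic Galilean mode is curl-free. -/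
theorem parasitic_curl (b : E3) (t : ℝ) (x : E3) : curl (parasitic b t) x = 0 :=
  ForceMeter.curl_const_eq_zero (t • b) x

/-- CONTROL: the parasitic mode satisfies the hypotheses of `Row_A2inA` (acceleration `≡ b`), `Row_A2inW`
(frozen vorticity) and `Row_A2inV` (recurrent vorticity) at EVERY instant with `b ≠ 0` allowed, and it is
nonzero — so it is NOT a Type-I ancient mild field: the decided rows are theorems about the GAUGE. -/
theorem parasitic_not_typeI {b : E3} (hb : b ≠ 0) (C : ℝ) : ¬ IsTypeIAncientMild C (parasitic b) := by
  intro hP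
  have h := eq_zero_of_accelInstant_germ hP (t₀ := -1) (by norm_num) isOpen_univ univ_nonempty
    (b := b) (fun x _ => parasitic_timeDeriv b (-1) x) (-1) (by norm_num) 0
  simp [parasitic, hb] at h

/-- CONTROL (kinematic): with the class dropped, vorticity-pocket data do NOT determine the field — the
potential flow `x ↦ b` (any constant) has the same (zero) vorticity as `0` on every pocket. -/
theorem control_potential (b : E3) (x : E3) : curl (fun _ : E3 => b) x = curl (fun _ : E3 => (0 : E3)) x := by
  rw [ForceMeter.curl_const_eq_zero, ForceMeter.curl_const_eq_zero]

end Summit.NavierStokesRegularity.NavierStokesRegularity.Theorems.ScenarioCensus.InertialMeter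

end
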